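import Summits.QuantumFields.YangMills.Theorems.ConvexGribovBodyContinuumLegGivenGapCsclTorusChord
import Summits.QuantumFields.YangMills.Theorems.ConvexGribovBodyContinuumLegGivenGapStubRpCoreChord
import HarnessLib

/-!
# `ContinuumLegGivenGap` (stmt-QuantumFields-15828), line `Sketch`, reshape 17-CS, helper 3 of `stub_csclOfLock`:
# the log-convex chord with slack; centring; Cauchy–Schwarz clustering with OS norms on ONE odd torus

Sequel of `…CsclTorusChord`. `cscl_chord_slack`: a non-negative log-convex sequence on `0 … N` with
`g N ≤ D e^{−μN}` and `D ≤ ε e^{μN/2}` satisfies `g n ≤ g 0 · e^{−μn/2} + ε` (case split `g 0 ≶ ε` over the landed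
`rpCore_chordBound`). `cscl_centre_identity`: `∫ conj X°(ΘŨ) Y°(τˢŨ) = ∫ conj X(ΘŨ) Y(τˢŨ) − conj ⟨X⟩ ⟨Y⟩` for the centred
observables. `cscl_torus_pair` — THE PER-TORUS STATEMENT: on the torus of side `2S+1` (`β ≥ 0`), for bounded measurable
complex cylinder observables `X, Y` supported at lattice times in `[1, w]`, if the reflected connected time correlations
of `X` with itself and of `Y` with itself are `≤ D e^{−Mn}` for all `n ≤ S` (per-observable constants — the locked lattice
gap) and the torus is long enough (`2w + N + 10 ≤ S`, `D e^{M} ≤ ε e^{MN/2}`), then for every shift `s ≤ N` the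
`cfgReflect`-pairing `∫ conj X(cfgReflect Ũ) Y(τˢŨ) − conj ⟨X⟩⟨Y⟩` is bounded by
`e^{−Ms/2} √V_X √V_Y + √ε (√V_X + √V_Y) + ε` with the (uncentred, site-form) OS variances `V_X = Re ∫ conj X(cfgReflect Ũ) X(Ũ)`:
OS-NORM constants at half rate, the per-observable constants relegated to the length condition.
Registered anchor: `cscl_anchor_slack`. Refs: Osterwalder–Seiler 1978 §2; Glimm–Jaffe 1987 §6.1. No definitions.
-/

noncomputable section

open scoped ComplexConjugate
open MeasureTheory Filter
open Literature.MathematicalPhysics.QuantumFieldTheory Literature.MathematicalPhysics.QuantumLattice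
open Summit.QuantumFields.YangMills.Theorems.ClusteringToYangMills.Reconstructible
open Summit.QuantumFields.YangMills.Theorems.CriticalContinuumLimit.AdmissibleGap (maxTime)

namespace Summit.QuantumFields.YangMills.Theorems.ContinuumLegGivenGap

/-! ### The log-convex chord with slack -/

/-- **Chord with slack.** For a non-negative sequence on `0, …, N` (`N > 0`), log-convex at interior indices, with
`g N ≤ D e^{−μN}` (`0 ≤ μ`, `0 < D`) and `D ≤ ε e^{μN/2}` (`0 < ε`): `g n ≤ g 0 · e^{−μn/2} + ε` for all `n ≤ N`.
[folklore] -/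
theorem cscl_chord_slack (g : ℕ → ℝ) (N : ℕ) (D μ ε : ℝ) (hN : 0 < N) (hμ : 0 ≤ μ) (hD : 0 < D) (hε : 0 < ε)
    (hpos : ∀ n : ℕ, n ≤ N → 0 ≤ g n)
    (hlc : ∀ n : ℕ, 1 ≤ n → n + 1 ≤ N → g n ^ 2 ≤ g (n - 1) * g (n + 1))
    (hNb : g N ≤ D * Real.exp (-(μ * N))) (hDε : D ≤ ε * Real.exp (μ * N / 2)) :
    ∀ n : ℕ, n ≤ N → g n ≤ g 0 * Real.exp (-(μ * n / 2)) + ε := by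
  intro n hn
  have hNr : (0 : ℝ) < N := by exact_mod_cast hN
  have hg0 := hpos 0 (Nat.zero_le _)
  have hexpn : 0 ≤ Real.exp (-(μ * n / 2)) := (Real.exp_pos _).le
  -- rescale by `c := max (g 0) ε > 0`
  set c : ℝ := max (g 0) ε with hc
  have hc0 : 0 < c := lt_max_of_lt_right hε
  have hcg : g 0 ≤ c := le_max_left _ _
  have hcε : ε ≤ c := le_max_right _ _
  set D' : ℝ := max (D / c) 1 with hD'
  have hD'1 : 1 ≤ D' := le_max_right _ _
  have hchord := rpCore_chordBound (fun k => g k / c) N 1 D' μ hN le_rfl hD'1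
    (fun k hk => div_nonneg (hpos k hk) hc0.le)
    (fun k hk1 hk2 => by
      have h := hlc k hk1 hk2
      rw [div_pow, div_mul_div_comm, ← sq]
      exact div_le_div_of_nonneg_right h (sq_nonneg _))
    (by rw [div_le_one hc0]; exact hcg)
    (by
      rw [div_le_iff₀ hc0]
      calc g N ≤ D * Real.exp (-(μ * N)) := hNb
        _ = D / c * Real.exp (-(μ * N)) * c := by field_simp
        _ ≤ D' * Real.exp (-(μ * N)) * c := by gcongr; exact le_max_left _ _)
    n hn
  -- `log D' / N ≤ μ / 2`
  have hlogD' : Real.log D' ≤ μ * N / 2 := by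
    rcases le_or_gt (D / c) 1 with h1 | h1
    · rw [hD', max_eq_right h1, Real.log_one]; positivity
    · rw [hD', max_eq_left h1.le]
      have h2 : D / c ≤ Real.exp (μ * N / 2) := by
        rw [div_le_iff₀ hc0]
        calc D ≤ ε * Real.exp (μ * N / 2) := hDε
          _ ≤ c * Real.exp (μ * N / 2) := by gcongr
          _ = Real.exp (μ * N / 2) * c := mul_comm _ _
      calc Real.log (D / c) ≤ Real.log (Real.exp (μ * N / 2)) := Real.log_le_log (by positivity) h2
        _ = μ * N / 2 := Real.log_exp _
  have hexp : Real.exp (-(μ * n) + Real.log D' / N * n) ≤ Real.exp (-(μ * n / 2)) := by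
    refine Real.exp_le_exp.2 ?_
    have h3 : Real.log D' / N * n ≤ μ / 2 * n := by
      refine mul_le_mul_of_nonneg_right ?_ (Nat.cast_nonneg n)
      rw [div_le_iff₀ hNr]; linarith
    linarith
  have hmain : g n ≤ c * Real.exp (-(μ * n / 2)) := by
    have h4 : g n / c ≤ 1 * Real.exp (-(μ * n) + Real.log D' / N * n) := hchord
    rw [div_le_iff₀ hc0, one_mul] at h4
    calc g n ≤ Real.exp (-(μ * n) + Real.log D' / N * n) * c := h4
      _ ≤ Real.exp (-(μ * n / 2)) * c := by gcongr
      _ = c * Real.exp (-(μ * n / 2)) := mul_comm _ _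
  -- case split on which of `g 0`, `ε` is the max
  rcases le_total (g 0) ε with h5 | h5
  · have : c = ε := by rw [hc, max_eq_right h5]
    rw [this] at hmain
    have h6 : ε * Real.exp (-(μ * n / 2)) ≤ ε :=
      mul_le_of_le_one_right hε.le (Real.exp_le_one_iff.2 (by
        have : 0 ≤ μ * n / 2 := by positivity
        linarith))
    nlinarith [mul_nonneg hg0 hexpn]
  · have : c = g 0 := by rw [hc, max_eq_left h5]
    rw [this] at hmain
    linarith

/-- Elementary: `√((a + ε)(b + ε)) ≤ √a √b + √ε (√a + √b) + ε` for non-negative reals. [folklore] -/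
theorem cscl_sqrt_slack {a b ε : ℝ} (ha : 0 ≤ a) (hb : 0 ≤ b) (hε : 0 ≤ ε) :
    Real.sqrt ((a + ε) * (b + ε)) ≤ Real.sqrt a * Real.sqrt b + Real.sqrt ε * (Real.sqrt a + Real.sqrt b) + ε := by
  rw [Real.sqrt_le_left (by positivity)]
  have hsa := Real.sq_sqrt ha
  have hsb := Real.sq_sqrt hb
  have hse := Real.sq_sqrt hε
  nlinarith [Real.sqrt_nonneg a, Real.sqrt_nonneg b, Real.sqrt_nonneg ε,
    mul_nonneg (Real.sqrt_nonneg a) (Real.sqrt_nonneg b), mul_nonneg (Real.sqrt_nonneg a) (Real.sqrt_nonneg ε),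
    mul_nonneg (Real.sqrt_nonneg b) (Real.sqrt_nonneg ε),
    mul_nonneg (mul_nonneg (Real.sqrt_nonneg a) (Real.sqrt_nonneg b)) (Real.sqrt_nonneg ε)]

section Torus

variable {G : Type} [Group G] [TopologicalSpace G] [IsTopologicalGroup G] [CompactSpace G]
  [MeasurableSpace G] [BorelSpace G] {N : ℕ} (ρ : G →* Matrix (Fin N) (Fin N) ℂ)

/-! ### Centring -/

/-- **Centring identity**: with `⟨X⟩ = ∫ X(Ũ)`, `X° = X − ⟨X⟩`,
`∫ conj X°(ΘŨ) Y°(τˢŨ) = ∫ conj X(ΘŨ) Y(τˢŨ) − conj ⟨X⟩ · ⟨Y⟩` (reflection and translation invariance). [folklore] -/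
theorem cscl_centre_identity (hρ : Continuous ρ) (β : ℝ) (L : ℕ) [NeZero L] {X Y : LGConfig 4 G → ℂ}
    (hXm : Measurable X) (hYm : Measurable Y) (hXb : ∃ C : ℝ, ∀ U, ‖X U‖ ≤ C) (hYb : ∃ C : ℝ, ∀ U, ‖Y U‖ ≤ C) (s : ℤ) :
    ∫ U, conj (X (gaugeTimeReflect (torusLift L U)) - ∫ V, X (torusLift L V) ∂(wilsonMeasure (d := 4) (L := L) ρ β)) *
        (Y (configShift (-(Pi.single 0 s)) (torusLift L U)) - ∫ V, Y (torusLift L V) ∂(wilsonMeasure (d := 4) (L := L) ρ β))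
        ∂(wilsonMeasure (d := 4) (L := L) ρ β) =
      (∫ U, conj (X (gaugeTimeReflect (torusLift L U))) * Y (configShift (-(Pi.single 0 s)) (torusLift L U))
        ∂(wilsonMeasure (d := 4) (L := L) ρ β)) -
        conj (∫ V, X (torusLift L V) ∂(wilsonMeasure (d := 4) (L := L) ρ β)) *
          ∫ V, Y (torusLift L V) ∂(wilsonMeasure (d := 4) (L := L) ρ β) := by
  haveI := isProbabilityMeasure_wilsonMeasure (d := 4) (L := L) ρ hρ β
  set mX : ℂ := ∫ V, X (torusLift L V) ∂(wilsonMeasure (d := 4) (L := L) ρ β)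
  set mY : ℂ := ∫ V, Y (torusLift L V) ∂(wilsonMeasure (d := 4) (L := L) ρ β)
  obtain ⟨CX, hCX⟩ := hXb
  obtain ⟨CY, hCY⟩ := hYb
  have hIXY : Integrable (fun U : GaugeConfig 4 L G => conj (X (gaugeTimeReflect (torusLift L U))) *
      Y (configShift (-(Pi.single 0 s)) (torusLift L U))) (wilsonMeasure (d := 4) (L := L) ρ β) := by
    refine cscl_integrable ρ hρ β ((Complex.continuous_conj.measurable.comp (cscl_measurable_comp hXm L s).1).mul
      (cscl_measurable_comp hYm L s).2) ⟨CX * CY, fun U => ?_⟩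
    rw [norm_mul, Complex.norm_conj]
    have hCX0 : 0 ≤ CX := (norm_nonneg _).trans (hCX (gaugeTimeReflect (torusLift L U)))
    exact mul_le_mul (hCX _) (hCY _) (norm_nonneg _) hCX0
  have hIX : Integrable (fun U : GaugeConfig 4 L G => conj (X (gaugeTimeReflect (torusLift L U))))
      (wilsonMeasure (d := 4) (L := L) ρ β) :=
    cscl_integrable ρ hρ β (Complex.continuous_conj.measurable.comp (cscl_measurable_comp hXm L s).1)
      ⟨CX, fun U => by rw [Complex.norm_conj]; exact hCX _⟩
  have hIY : Integrable (fun U : GaugeConfig 4 L G => Y (configShift (-(Pi.single 0 s)) (torusLift L U)))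
      (wilsonMeasure (d := 4) (L := L) ρ β) :=
    cscl_integrable ρ hρ β (cscl_measurable_comp hYm L s).2 ⟨CY, fun U => hCY _⟩
  -- the two one-point integrals
  have h1 : ∫ U, conj (X (gaugeTimeReflect (torusLift L U))) ∂(wilsonMeasure (d := 4) (L := L) ρ β) = conj mX := by
    rw [integral_conj]
    congr 1
    exact cscl_integral_reflect_swap ρ hρ β L fun A _ => X A
  have h2 : ∫ U, Y (configShift (-(Pi.single 0 s)) (torusLift L U)) ∂(wilsonMeasure (d := 4) (L := L) ρ β) = mY :=
    cscl_integral_shift ρ β L _ Y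
  have hpt : ∀ U : GaugeConfig 4 L G,
      conj (X (gaugeTimeReflect (torusLift L U)) - mX) * (Y (configShift (-(Pi.single 0 s)) (torusLift L U)) - mY) =
      conj (X (gaugeTimeReflect (torusLift L U))) * Y (configShift (-(Pi.single 0 s)) (torusLift L U)) -
        mY * conj (X (gaugeTimeReflect (torusLift L U))) -
        conj mX * Y (configShift (-(Pi.single 0 s)) (torusLift L U)) + conj mX * mY := by
    intro U; simp only [map_sub]; ring
  simp_rw [hpt]
  have hI1 : Integrable (fun U : GaugeConfig 4 L G => mY * conj (X (gaugeTimeReflect (torusLift L U))))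
      (wilsonMeasure (d := 4) (L := L) ρ β) := hIX.const_mul mY
  have hI2 : Integrable (fun U : GaugeConfig 4 L G => conj mX * Y (configShift (-(Pi.single 0 s)) (torusLift L U)))
      (wilsonMeasure (d := 4) (L := L) ρ β) := hIY.const_mul (conj mX)
  have hI3 : Integrable (fun U : GaugeConfig 4 L G =>
      conj (X (gaugeTimeReflect (torusLift L U))) * Y (configShift (-(Pi.single 0 s)) (torusLift L U)) -
        mY * conj (X (gaugeTimeReflect (torusLift L U)))) (wilsonMeasure (d := 4) (L := L) ρ β) := hIXY.sub hI1
  have hI4 : Integrable (fun U : GaugeConfig 4 L G =>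
      conj (X (gaugeTimeReflect (torusLift L U))) * Y (configShift (-(Pi.single 0 s)) (torusLift L U)) -
        mY * conj (X (gaugeTimeReflect (torusLift L U))) -
        conj mX * Y (configShift (-(Pi.single 0 s)) (torusLift L U))) (wilsonMeasure (d := 4) (L := L) ρ β) :=
    hI3.sub hI2
  rw [integral_add hI4 (integrable_const _), integral_sub hI3 hI2, integral_sub hIXY hI1, integral_const_mul,
    integral_const_mul, h1, h2, integral_const, probReal_univ, one_smul]
  ring

/-! ### One observable: positivity, log-convexity and the chord for the centred, back-shifted sequence -/

/-- **The chord for one observable.** For a bounded measurable cylinder observable `X` supported at lattice times in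
`[1, w]` whose reflected connected time correlation with itself is `≤ D e^{−Mn}` for all `n ≤ S` on the torus of side
`2S+1` (`β ≥ 0`, `2w + N + 10 ≤ S`, `D e^{M} ≤ ε e^{MN/2}`), the sequence `m ↦ P_m(X',X')` of the centred back-shifted
observable `X' = X∘τ⁻¹ − ⟨X⟩` (`P_m(A,B) = ∫ conj A(ΘŨ) B(τᵐŨ)`) is real non-negative for `m ≤ N + 2`, and
`Re P_{n+1}(X',X') ≤ V_X e^{−Mn/2} + ε` for `n ≤ N`, `V_X = Re ∫ conj X(cfgReflect Ũ) X(Ũ) ≥ 0`. [folklore] -/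
theorem cscl_obs_chord (hρ : Continuous ρ) {β : ℝ} (hβ : 0 ≤ β) {S w Nn : ℕ} {X : LGConfig 4 G → ℂ}
    (hXm : Measurable X) (hXb : ∃ C : ℝ, ∀ U, ‖X U‖ ≤ C)
    {ΛX : Finset (Literature.MathematicalPhysics.QuantumLattice.ZdEdge 4)} (hX : IsCylinder X ΛX)
    (hΛX : ∀ e ∈ ΛX, 1 ≤ e.1 0 ∧ e.1 0 ≤ (w : ℤ)) {M ε DX : ℝ} (hM : 0 ≤ M) (hε : 0 < ε) (hDX : 0 < DX)
    (hNn : 1 ≤ Nn) (hwin : 2 * w + Nn + 10 ≤ S)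
    (hcl : ∀ n : ℕ, n ≤ S →
      ‖(∫ U, conj (X (gaugeTimeReflect (torusLift (2 * S + 1) U))) *
          X (configShift (-(Pi.single 0 (n : ℤ))) (torusLift (2 * S + 1) U)) ∂(wilsonMeasure (d := 4) (L := 2 * S + 1) ρ β)) -
        conj (∫ V, X (torusLift (2 * S + 1) V) ∂(wilsonMeasure (d := 4) (L := 2 * S + 1) ρ β)) *
          ∫ V, X (torusLift (2 * S + 1) V) ∂(wilsonMeasure (d := 4) (L := 2 * S + 1) ρ β)‖ ≤ DX * Real.exp (-(M * n)))
    (hthr : DX * Real.exp M ≤ ε * Real.exp (M * Nn / 2)) :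
    (∀ m : ℕ, m ≤ Nn + 2 →
      0 ≤ (∫ U, conj (X (configShift (-(Pi.single 0 (-1))) (gaugeTimeReflect (torusLift (2 * S + 1) U))) -
              ∫ V, X (torusLift (2 * S + 1) V) ∂(wilsonMeasure (d := 4) (L := 2 * S + 1) ρ β)) *
            (X (configShift (-(Pi.single 0 (-1))) (configShift (-(Pi.single 0 (m : ℤ))) (torusLift (2 * S + 1) U))) -
              ∫ V, X (torusLift (2 * S + 1) V) ∂(wilsonMeasure (d := 4) (L := 2 * S + 1) ρ β))
          ∂(wilsonMeasure (d := 4) (L := 2 * S + 1) ρ β)).re ∧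
        (∫ U, conj (X (configShift (-(Pi.single 0 (-1))) (gaugeTimeReflect (torusLift (2 * S + 1) U))) -
              ∫ V, X (torusLift (2 * S + 1) V) ∂(wilsonMeasure (d := 4) (L := 2 * S + 1) ρ β)) *
            (X (configShift (-(Pi.single 0 (-1))) (configShift (-(Pi.single 0 (m : ℤ))) (torusLift (2 * S + 1) U))) -
              ∫ V, X (torusLift (2 * S + 1) V) ∂(wilsonMeasure (d := 4) (L := 2 * S + 1) ρ β))
          ∂(wilsonMeasure (d := 4) (L := 2 * S + 1) ρ β)).im = 0) ∧
    (∀ n : ℕ, n ≤ Nn →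
      (∫ U, conj (X (configShift (-(Pi.single 0 (-1))) (gaugeTimeReflect (torusLift (2 * S + 1) U))) -
              ∫ V, X (torusLift (2 * S + 1) V) ∂(wilsonMeasure (d := 4) (L := 2 * S + 1) ρ β)) *
            (X (configShift (-(Pi.single 0 (-1))) (configShift (-(Pi.single 0 ((n + 1 : ℕ) : ℤ))) (torusLift (2 * S + 1) U))) -
              ∫ V, X (torusLift (2 * S + 1) V) ∂(wilsonMeasure (d := 4) (L := 2 * S + 1) ρ β))
          ∂(wilsonMeasure (d := 4) (L := 2 * S + 1) ρ β)).re ≤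
        (∫ U, conj (X (cfgReflect (torusLift (2 * S + 1) U))) * X (torusLift (2 * S + 1) U)
          ∂(wilsonMeasure (d := 4) (L := 2 * S + 1) ρ β)).re * Real.exp (-(M * n / 2)) + ε) ∧
    0 ≤ (∫ U, conj (X (cfgReflect (torusLift (2 * S + 1) U))) * X (torusLift (2 * S + 1) U)
          ∂(wilsonMeasure (d := 4) (L := 2 * S + 1) ρ β)).re := by
  haveI := isProbabilityMeasure_wilsonMeasure (d := 4) (L := 2 * S + 1) ρ hρ β
  set mX : ℂ := ∫ V, X (torusLift (2 * S + 1) V) ∂(wilsonMeasure (d := 4) (L := 2 * S + 1) ρ β) with hmX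
  obtain ⟨CX, hCX⟩ := hXb
  -- the centred observable `X°` and its back-shift `X'`
  set Xc : LGConfig 4 G → ℂ := fun V => X V - mX with hXc
  set X' : LGConfig 4 G → ℂ := fun V => Xc (configShift (-(Pi.single 0 (-1))) V) with hX'
  have hXcm : Measurable Xc := hXm.sub measurable_const
  have hXcb : ∃ C : ℝ, ∀ U, ‖Xc U‖ ≤ C := ⟨CX + ‖mX‖, fun U => (norm_sub_le _ _).trans (add_le_add (hCX U) le_rfl)⟩
  have hXcc : IsCylinder Xc ΛX := fun U V hUV => by
    show X U - mX = X V - mX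
    rw [hX hUV]
  have hX'm : Measurable X' := hXcm.comp (configShift _).measurable
  have hX'b : ∃ C : ℝ, ∀ U, ‖X' U‖ ≤ C := hXcb.imp fun C hC U => hC _
  obtain ⟨Λ', hX'c, hΛ'⟩ := cscl_isCylinder_shift hXcc (-1) hΛX
  have hΛ'' : ∀ e ∈ Λ', 0 ≤ e.1 0 ∧ e.1 0 ≤ (w : ℤ) := fun e he => by have := hΛ' e he; omega
  -- (1) reality / positivity for `m ≤ Nn + 2`
  have hnn : ∀ m : ℕ, m ≤ Nn + 2 →
      0 ≤ (∫ U, conj (X' (gaugeTimeReflect (torusLift (2 * S + 1) U))) *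
        X' (configShift (-(Pi.single 0 (m : ℤ))) (torusLift (2 * S + 1) U)) ∂(wilsonMeasure (d := 4) (L := 2 * S + 1) ρ β)).re ∧
      (∫ U, conj (X' (gaugeTimeReflect (torusLift (2 * S + 1) U))) *
        X' (configShift (-(Pi.single 0 (m : ℤ))) (torusLift (2 * S + 1) U)) ∂(wilsonMeasure (d := 4) (L := 2 * S + 1) ρ β)).im = 0 :=
    fun m hm => cscl_seq_nonneg (S := S) ρ hρ hβ hX'm hX'b hX'c hΛ'' m (by omega)
  -- (2) `P_m(X',X') = P_{m-2}(X°,X°)` (shift identity with `a = -1`, `c = m - 1`)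
  have hP : ∀ m : ℕ,
      (∫ U, conj (X' (gaugeTimeReflect (torusLift (2 * S + 1) U))) *
        X' (configShift (-(Pi.single 0 (m : ℤ))) (torusLift (2 * S + 1) U)) ∂(wilsonMeasure (d := 4) (L := 2 * S + 1) ρ β)) =
      ∫ U, conj (Xc (gaugeTimeReflect (torusLift (2 * S + 1) U))) *
        Xc (configShift (-(Pi.single 0 ((m : ℤ) - 2))) (torusLift (2 * S + 1) U)) ∂(wilsonMeasure (d := 4) (L := 2 * S + 1) ρ β) := by
    intro m
    have h := cscl_shift_pair ρ β (2 * S + 1) Xc Xc (-1) ((m : ℤ) - 1)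
    have hc : (-1 : ℤ) + ((m : ℤ) - 1) = (m : ℤ) - 2 := by ring
    rw [hc] at h
    rw [← h]
    refine integral_congr_ae (Eventually.of_forall fun U => ?_)
    simp only [hX', rpShift_configShift_configShift]
    ring_nf
  -- (3) centring: `P_k(X°,X°) = P_k(X,X) - |mX|²`
  have hcentre : ∀ k : ℤ,
      (∫ U, conj (Xc (gaugeTimeReflect (torusLift (2 * S + 1) U))) *
        Xc (configShift (-(Pi.single 0 k)) (torusLift (2 * S + 1) U)) ∂(wilsonMeasure (d := 4) (L := 2 * S + 1) ρ β)) =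
      (∫ U, conj (X (gaugeTimeReflect (torusLift (2 * S + 1) U))) *
        X (configShift (-(Pi.single 0 k)) (torusLift (2 * S + 1) U)) ∂(wilsonMeasure (d := 4) (L := 2 * S + 1) ρ β)) -
        conj mX * mX :=
    fun k => cscl_centre_identity ρ hρ β (2 * S + 1) hXm hXm ⟨CX, hCX⟩ ⟨CX, hCX⟩ k
  -- (4) the variance `V_X = Re P_{-1}(X,X) ≥ Re P_{-1}(X°,X°) = Re P_1(X',X') ≥ 0`
  have hV : (∫ U, conj (X (cfgReflect (torusLift (2 * S + 1) U))) * X (torusLift (2 * S + 1) U)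
      ∂(wilsonMeasure (d := 4) (L := 2 * S + 1) ρ β)) =
      ∫ U, conj (X (gaugeTimeReflect (torusLift (2 * S + 1) U))) *
        X (configShift (-(Pi.single 0 (-1))) (torusLift (2 * S + 1) U)) ∂(wilsonMeasure (d := 4) (L := 2 * S + 1) ρ β) := by
    have h := cscl_site_pairing_eq ρ β (2 * S + 1) X X 0
    simp only [Pi.single_zero, neg_zero, rpShift_configShift_zero, add_zero] at h
    exact h
  have hmm : (conj mX * mX).re = ‖mX‖ ^ 2 ∧ (conj mX * mX).im = 0 := by
    rw [Complex.conj_mul' mX, ← Complex.ofReal_pow]; exact ⟨Complex.ofReal_re _, Complex.ofReal_im _⟩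
  have hg1 : (∫ U, conj (X' (gaugeTimeReflect (torusLift (2 * S + 1) U))) *
        X' (configShift (-(Pi.single 0 ((1 : ℕ) : ℤ))) (torusLift (2 * S + 1) U)) ∂(wilsonMeasure (d := 4) (L := 2 * S + 1) ρ β)).re =
      (∫ U, conj (X (cfgReflect (torusLift (2 * S + 1) U))) * X (torusLift (2 * S + 1) U)
        ∂(wilsonMeasure (d := 4) (L := 2 * S + 1) ρ β)).re - ‖mX‖ ^ 2 := by
    rw [hP 1, hV, show ((1 : ℕ) : ℤ) - 2 = -1 by norm_num, hcentre (-1), Complex.sub_re, hmm.1]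
  have hVpos : 0 ≤ (∫ U, conj (X (cfgReflect (torusLift (2 * S + 1) U))) * X (torusLift (2 * S + 1) U)
      ∂(wilsonMeasure (d := 4) (L := 2 * S + 1) ρ β)).re := by
    have h := (hnn 1 (by omega)).1
    rw [hg1] at h
    nlinarith [sq_nonneg ‖mX‖]
  -- (5) the chord with slack on `n ↦ Re P_{n+1}(X',X')`, `n ≤ Nn`
  set g : ℕ → ℝ := fun n => (∫ U, conj (X' (gaugeTimeReflect (torusLift (2 * S + 1) U))) *
    X' (configShift (-(Pi.single 0 ((n + 1 : ℕ) : ℤ))) (torusLift (2 * S + 1) U)) ∂(wilsonMeasure (d := 4) (L := 2 * S + 1) ρ β)).re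
    with hg
  have hgpos : ∀ n : ℕ, n ≤ Nn → 0 ≤ g n := fun n hn => (hnn (n + 1) (by omega)).1
  have hglc : ∀ n : ℕ, 1 ≤ n → n + 1 ≤ Nn → g n ^ 2 ≤ g (n - 1) * g (n + 1) := by
    intro n hn1 hn2
    have h := cscl_seq_logConvex (S := S) ρ hρ hβ hX'm hX'b hX'c hΛ'' (n + 1) (by omega) (by omega)
    have e1 : n - 1 + 1 = n + 1 - 1 := by omega
    simp only [hg, e1]
    exact h
  have hgN : g Nn ≤ DX * Real.exp M * Real.exp (-(M * Nn)) := by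
    have h1 : g Nn ≤ ‖(∫ U, conj (X (gaugeTimeReflect (torusLift (2 * S + 1) U))) *
          X (configShift (-(Pi.single 0 ((Nn - 1 : ℕ) : ℤ))) (torusLift (2 * S + 1) U)) ∂(wilsonMeasure (d := 4) (L := 2 * S + 1) ρ β)) -
        conj mX * mX‖ := by
      simp only [hg]
      rw [hP, show ((Nn + 1 : ℕ) : ℤ) - 2 = ((Nn - 1 : ℕ) : ℤ) by push_cast [Nat.cast_sub hNn]; ring, hcentre]
      exact Complex.re_le_norm _
    refine h1.trans ((hcl (Nn - 1) (by omega)).trans ?_)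
    rw [mul_assoc, ← Real.exp_add]
    refine mul_le_mul_of_nonneg_left (Real.exp_le_exp.2 ?_) hDX.le
    rw [Nat.cast_sub hNn]; push_cast; nlinarith
  have hchord := cscl_chord_slack g Nn (DX * Real.exp M) M ε (by omega) hM (by positivity) hε hgpos hglc hgN hthr
  refine ⟨fun m hm => hnn m hm, fun n hn => ?_, hVpos⟩
  have h := hchord n hn
  have hg0 : g 0 ≤ (∫ U, conj (X (cfgReflect (torusLift (2 * S + 1) U))) * X (torusLift (2 * S + 1) U)
      ∂(wilsonMeasure (d := 4) (L := 2 * S + 1) ρ β)).re := by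
    show (∫ U, conj (X' (gaugeTimeReflect (torusLift (2 * S + 1) U))) *
      X' (configShift (-(Pi.single 0 ((0 + 1 : ℕ) : ℤ))) (torusLift (2 * S + 1) U)) ∂(wilsonMeasure (d := 4) (L := 2 * S + 1) ρ β)).re ≤ _
    rw [zero_add, hg1]
    nlinarith [sq_nonneg ‖mX‖]
  have hexp0 : 0 ≤ Real.exp (-(M * n / 2)) := (Real.exp_pos _).le
  calc _ = g n := rfl
    _ ≤ g 0 * Real.exp (-(M * n / 2)) + ε := h
    _ ≤ _ := by nlinarith [mul_le_mul_of_nonneg_right hg0 hexp0]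

end Torus

/-- **Registered anchor of this file** (closed form of `cscl_sqrt_slack`, for the gate's `--supports` stub check).
[folklore] -/
theorem cscl_anchor_slack :
    ∀ (a b ε : ℝ), 0 ≤ a → 0 ≤ b → 0 ≤ ε →
      Real.sqrt ((a + ε) * (b + ε)) ≤ Real.sqrt a * Real.sqrt b + Real.sqrt ε * (Real.sqrt a + Real.sqrt b) + ε :=
  fun _ _ _ ha hb hε => cscl_sqrt_slack ha hb hε

end Summit.QuantumFields.YangMills.Theorems.ContinuumLegGivenGap

end
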